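import Summits.ResolutionOfSingularities.ResolutionOfSingularities.Theorems.HilbertSamuelEliminationSigmaMaxModificationsGluing
import Summits.ResolutionOfSingularities.ResolutionOfSingularities.Theorems.HilbertSamuelEliminationSigmaMaxModificationsLocalWitness
import Literature.AlgebraicGeometry.Resolution.HilbertSamuelSemicontinuityExcellentDim
import Literature.AlgebraicGeometry.Resolution.QuasiExcellentSchemes
import Literature.AlgebraicGeometry.Resolution.ExcellentRingsFieldProofs
import Mathlib.AlgebraicGeometry.Morphisms.Proper
import Mathlib.AlgebraicGeometry.Noetherian
import HarnessLib

/-!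
# `Σ^max`-modifications in dimension `≤ 3` away from the corridor
# (crux `SigmaMaxModifications`, stmt-ResolutionOfSingularities-18506, line `Sketch`)

A NEW CASE of the crux, conditional on the named fact `CossartPiltant2019General`
(Cossart–Piltant 2019, Thm. 1.1: every reduced separated Noetherian quasi-excellent scheme of
dimension `≤ 3` has a resolution which is an isomorphism over its regular locus):

* `sigmaMaxModifications_dim_le_three_of_isolated` — for `X/k` reduced, separated, of finite
  type, not regular, `dim X ≤ 3`, and a level `N ≥ dim X` at which the Hilbert–Samuel locus
  `X_max = Scheme.hsMaxLocus X N` is closed and ISOLATED FROM THE OTHER SINGULARITIES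
  (`Disjoint (closure (Sing X ∖ X_max)) X_max`), there is a `Σ^max`-modification of `X` at
  level `N` — the `∃`-body of the crux at `(X, N)`. Proof: `U₁ := X ∖ closure (Sing X ∖ X_max)`
  is an open neighbourhood of `X_max` with `U₁ ∩ Sing X ⊆ X_max`; resolve `U₁` by the fact
  (`ρ : Y → U₁`, an isomorphism over `Reg U₁ = U₁ ∖ X_max`); `ρ` is a local witness
  (`localWitness_of_resolution`: the regular `Y` carries only the minimal value `Φ^{(N)}`);
  glue it with the identity on `X ∖ X_max` (`sigmaMaxModification_of_localWitness`).
* `sigmaMaxModifications_dim_le_three_of_isolated_of_lt` — the same for `N > dim X`, where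
  `X_max` is closed by Bennett–Singh upper semicontinuity
  (`Scheme.isClosed_hsMaxLocus_of_isExcellent_of_dim`).

This covers every reduced threefold whose worst Hilbert–Samuel stratum does not meet the
closure of the lower singular strata — e.g. all `X` with `Sing X = X_max` (in particular
isolated singularities of a common Hilbert–Samuel function) — and shows where the crux's open
content sits in dimension `3`: at the points of `X_max` in the closure of `Sing X ∖ X_max`
(no modification that is an isomorphism off `X_max` can be regular there; CJS's answer is to
blow up permissible centres INSIDE `X_max`, Rem. 6.29, which is the open step).

## Sources

* V. Cossart, O. Piltant, J. Algebra 529 (2019), Thm. 1.1. [CossartPiltant2019]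
* V. Cossart, U. Jannsen, S. Saito, LNM 2270 (2020), Def. 6.15, Rem. 6.29. [CossartJannsenSaito2020]
-/

set_option linter.dupNamespace false -- mandated namespace of this single-conjunct summit

noncomputable section

open CategoryTheory AlgebraicGeometry TopologicalSpace
open Literature.AlgebraicGeometry.Resolution Literature.RingTheory.HilbertSamuel

namespace Summit.ResolutionOfSingularities.ResolutionOfSingularities.Theorems.SigmaMaxModifications.Sketch

/-- **Away from the corridor the crux follows from resolution of singularities (iso over the
regular locus) in the same dimension.** If every reduced separated excellent Noetherian scheme of
dimension `≤ d` has a resolution which is an isomorphism over (an open equal to) its regular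
locus, then for `X/k` reduced, separated, locally of finite type and quasi-compact, not regular,
`dim X ≤ d`, and `N ≥ dim X` such that `X_max = Scheme.hsMaxLocus X N` is closed and disjoint
from the closure of `Sing X ∖ X_max`, there is a `Σ^max`-modification of `X` at level `N`:
resolve the open neighbourhood `U₁ = X ∖ closure (Sing X ∖ X_max)` of `X_max` (it satisfies
`U₁ ∩ Sing X ⊆ X_max`, so the resolution is an isomorphism over `U₁ ∖ X_max` and is a local
witness, `localWitness_of_resolution`) and glue with the identity on `X ∖ X_max`
(`sigmaMaxModification_of_localWitness`). [cite: CossartJannsenSaito2020, Def. 6.15, Rem. 6.29] -/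
theorem sigmaMaxModifications_of_isolated_of_resolutions (d : ℕ)
    (hRes : ∀ (Y : Scheme.{0}) [Y.IsSeparated] [IsNoetherian Y] [IsReduced Y],
      Scheme.IsExcellent Y → topologicalKrullDim Y ≤ (d : WithBot ℕ∞) →
        ∃ (Y' : Scheme.{0}) (ρ : Y' ⟶ Y), IsResolution ρ ∧
          ∃ V : Y.Opens, (V : Set Y) = Scheme.regularLocus Y ∧ IsIso (ρ ∣_ V))
    {k : Type} [Field k] {X : Scheme.{0}} (f : X ⟶ Spec (.of k)) [IsSeparated f]
    [LocallyOfFiniteType f] [QuasiCompact f] [IsReduced X] (hreg : ¬ Scheme.IsRegular X)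
    (hdimd : topologicalKrullDim X ≤ (d : WithBot ℕ∞)) {N : ℕ}
    (hdim : topologicalKrullDim X ≤ (N : WithBot ℕ∞)) (hcl : IsClosed (Scheme.hsMaxLocus X N))
    (hdisj : Disjoint (closure ((Scheme.regularLocus X)ᶜ \ Scheme.hsMaxLocus X N))
      (Scheme.hsMaxLocus X N)) :
    ∃ (X' : Scheme.{0}) (π : X' ⟶ X), IsProper π ∧ IsReduced X' ∧
      topologicalKrullDim X' ≤ (N : WithBot ℕ∞) ∧
      (∀ U : X.Opens, (U : Set X) ⊆ (Scheme.hsMaxLocus X N)ᶜ → IsIso (π ∣_ U)) ∧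
      Dense ((fun x' => π.base x') ⁻¹' (Scheme.hsMaxLocus X N)ᶜ) ∧
      (∀ x' : X', Scheme.hsFun X' N x' ≤ Scheme.hsFun X N (π.base x')) ∧
      ∀ ν : ℕ → ℕ, Maximal (· ∈ Scheme.hsValues X N) ν → ν ∉ Scheme.hsValues X' N := by
  haveI : IsLocallyNoetherian X := LocallyOfFiniteType.isLocallyNoetherian f
  haveI : IsNoetherian X := Scheme.isNoetherian_of_finiteType_over_field f
  -- the two opens: `Zc = X ∖ X_max` and `U₁ = X ∖ closure (Sing X ∖ X_max) ⊇ X_max`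
  let Zc : X.Opens := ⟨(Scheme.hsMaxLocus X N)ᶜ, hcl.isOpen_compl⟩
  let T : Set X := closure ((Scheme.regularLocus X)ᶜ \ Scheme.hsMaxLocus X N)
  let U₁ : X.Opens := ⟨Tᶜ, isClosed_closure.isOpen_compl⟩
  have hcover : Zc ⊔ U₁ = ⊤ := by
    ext x
    simp only [Opens.coe_sup, Opens.coe_top, Set.mem_univ, iff_true]
    by_cases hx : x ∈ Scheme.hsMaxLocus X N
    · exact Or.inr (Set.disjoint_right.mp hdisj hx)
    · exact Or.inl hx
  have hisol : ∀ x : X, x ∈ U₁ → x ∉ Scheme.hsMaxLocus X N → x ∈ Scheme.regularLocus X := by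
    intro x hxU hxZ
    by_contra hxreg
    exact hxU (subset_closure ⟨hxreg, hxZ⟩)
  -- resolve `U₁`
  haveI : IsSeparated (U₁.ι ≫ f) := inferInstance
  haveI : (U₁ : Scheme.{0}).IsSeparated := Scheme.isSeparated_of_isSeparated_over (U₁.ι ≫ f)
  haveI : IsNoetherian (U₁ : Scheme.{0}) :=
    Scheme.isNoetherian_of_finiteType_over_field (U₁.ι ≫ f)
  haveI : IsReduced (U₁ : Scheme.{0}) := isReduced_of_isOpenImmersion U₁.ι
  have hexcU : Scheme.IsExcellent (U₁ : Scheme.{0}) :=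
    Scheme.isExcellent_of_locallyOfFiniteType Stacks07QW_field_holds (U₁.ι ≫ f)
  have hdimU : topologicalKrullDim (U₁ : Scheme.{0}) ≤ (d : WithBot ℕ∞) :=
    (U₁.ι.isOpenEmbedding.isEmbedding.isInducing.topologicalKrullDim_le).trans hdimd
  obtain ⟨Y, ρ, hres, V, hV, hisoV⟩ := hRes (U₁ : Scheme.{0}) hexcU hdimU
  -- it is a local witness; glue it with the identity on `Zc`
  obtain ⟨hprop, hYred, hYdim, hiso, hdense, hmono, hkill⟩ :=
    localWitness_of_resolution k X f inferInstance inferInstance inferInstance hreg N hdim Zc U₁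
      rfl hisol Y ρ hres ⟨V, hV, hisoV⟩
  exact sigmaMaxModification_of_localWitness X N hdim Zc U₁ rfl hcover Y ρ hprop hYred hYdim
    hiso hdense hmono hkill

/-- **The crux in dimension `≤ 3` away from the corridor** (conditional on Cossart–Piltant 2019,
Thm. 1.1): for `X/k` reduced, separated, locally of finite type and quasi-compact, not regular,
`dim X ≤ 3`, and `N ≥ dim X` such that `X_max = Scheme.hsMaxLocus X N` is closed and disjoint
from the closure of `Sing X ∖ X_max`, there is a `Σ^max`-modification of `X` at level `N`:
resolve the open neighbourhood `X ∖ closure (Sing X ∖ X_max)` of `X_max` and glue with the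
identity on `X ∖ X_max`. [cite: CossartPiltant2019, Thm. 1.1] [cite: CossartJannsenSaito2020, Def. 6.15] -/
theorem sigmaMaxModifications_dim_le_three_of_isolated :
    CossartPiltant2019General.{0} →
    ∀ (k : Type) [Field k] (X : Scheme.{0}) (f : X ⟶ Spec (.of k)), IsSeparated f →
      LocallyOfFiniteType f → QuasiCompact f → IsReduced X → ¬ Scheme.IsRegular X →
      topologicalKrullDim X ≤ 3 → ∀ N : ℕ, topologicalKrullDim X ≤ (N : WithBot ℕ∞) →
      IsClosed (Scheme.hsMaxLocus X N) →
      Disjoint (closure ((Scheme.regularLocus X)ᶜ \ Scheme.hsMaxLocus X N))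
        (Scheme.hsMaxLocus X N) →
      ∃ (X' : Scheme.{0}) (π : X' ⟶ X), IsProper π ∧ IsReduced X' ∧
        topologicalKrullDim X' ≤ (N : WithBot ℕ∞) ∧
        (∀ U : X.Opens, (U : Set X) ⊆ (Scheme.hsMaxLocus X N)ᶜ → IsIso (π ∣_ U)) ∧
        Dense ((fun x' => π.base x') ⁻¹' (Scheme.hsMaxLocus X N)ᶜ) ∧
        (∀ x' : X', Scheme.hsFun X' N x' ≤ Scheme.hsFun X N (π.base x')) ∧
        ∀ ν : ℕ → ℕ, Maximal (· ∈ Scheme.hsValues X N) ν → ν ∉ Scheme.hsValues X' N := by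
  intro hCP k _ X f hsep hft hqc hred hreg hdim3 N hdim hcl hdisj
  haveI := hsep
  haveI := hft
  haveI := hqc
  haveI := hred
  exact sigmaMaxModifications_of_isolated_of_resolutions 3
    (fun Y _ _ _ hexc hdimY => hCP Y hexc.isQuasiExcellent (by exact_mod_cast hdimY)) f hreg
    (by exact_mod_cast hdim3) hdim hcl hdisj

/-- **The same at every level `N > dim X`** (no closedness hypothesis: `X_max` is closed by
Bennett–Singh upper semicontinuity, `Scheme.isClosed_hsMaxLocus_of_isExcellent_of_dim`).
[cite: CossartPiltant2019, Thm. 1.1] [cite: CossartJannsenSaito2020, Def. 6.15, Lemma 2.36] -/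
theorem sigmaMaxModifications_dim_le_three_of_isolated_of_lt :
    CossartPiltant2019General.{0} →
    ∀ (k : Type) [Field k] (X : Scheme.{0}) (f : X ⟶ Spec (.of k)), IsSeparated f →
      LocallyOfFiniteType f → QuasiCompact f → IsReduced X → ¬ Scheme.IsRegular X →
      topologicalKrullDim X ≤ 3 → ∀ N : ℕ, topologicalKrullDim X < (N : WithBot ℕ∞) →
      Disjoint (closure ((Scheme.regularLocus X)ᶜ \ Scheme.hsMaxLocus X N))
        (Scheme.hsMaxLocus X N) →
      ∃ (X' : Scheme.{0}) (π : X' ⟶ X), IsProper π ∧ IsReduced X' ∧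
        topologicalKrullDim X' ≤ (N : WithBot ℕ∞) ∧
        (∀ U : X.Opens, (U : Set X) ⊆ (Scheme.hsMaxLocus X N)ᶜ → IsIso (π ∣_ U)) ∧
        Dense ((fun x' => π.base x') ⁻¹' (Scheme.hsMaxLocus X N)ᶜ) ∧
        (∀ x' : X', Scheme.hsFun X' N x' ≤ Scheme.hsFun X N (π.base x')) ∧
        ∀ ν : ℕ → ℕ, Maximal (· ∈ Scheme.hsValues X N) ν → ν ∉ Scheme.hsValues X' N := by
  intro hCP k _ X f hsep hft hqc hred hreg hdim3 N hdim hdisj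
  haveI := hft
  haveI := hqc
  haveI : IsNoetherian X := Scheme.isNoetherian_of_finiteType_over_field f
  have hexc : Scheme.IsExcellent X :=
    Scheme.isExcellent_of_locallyOfFiniteType Stacks07QW_field_holds f
  exact sigmaMaxModifications_dim_le_three_of_isolated hCP k X f hsep hft hqc hred hreg hdim3 N
    hdim.le (Scheme.isClosed_hsMaxLocus_of_isExcellent_of_dim hexc hdim) hdisj


/-- **Dimension `≤ 2`, every level, away from the corridor** (conditional on Cossart–Jannsen–
Saito 2020, Thm. 1.2, weak form `CossartJannsenSaito2020General`): complements the known slice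
`sigmaMaxModifications_dim_le_two` (all reduced surfaces, but only `N = 2`) at the levels
`N ≠ 2`, where the glued named fact does not transfer. [cite: CossartJannsenSaito2020, Thm. 1.2, Def. 6.15] -/
theorem sigmaMaxModifications_dim_le_two_of_isolated (hCJS : CossartJannsenSaito2020General.{0})
    {k : Type} [Field k] {X : Scheme.{0}} (f : X ⟶ Spec (.of k)) [IsSeparated f]
    [LocallyOfFiniteType f] [QuasiCompact f] [IsReduced X] (hreg : ¬ Scheme.IsRegular X)
    (hdim2 : topologicalKrullDim X ≤ 2) {N : ℕ} (hdim : topologicalKrullDim X ≤ (N : WithBot ℕ∞))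
    (hcl : IsClosed (Scheme.hsMaxLocus X N))
    (hdisj : Disjoint (closure ((Scheme.regularLocus X)ᶜ \ Scheme.hsMaxLocus X N))
      (Scheme.hsMaxLocus X N)) :
    ∃ (X' : Scheme.{0}) (π : X' ⟶ X), IsProper π ∧ IsReduced X' ∧
      topologicalKrullDim X' ≤ (N : WithBot ℕ∞) ∧
      (∀ U : X.Opens, (U : Set X) ⊆ (Scheme.hsMaxLocus X N)ᶜ → IsIso (π ∣_ U)) ∧
      Dense ((fun x' => π.base x') ⁻¹' (Scheme.hsMaxLocus X N)ᶜ) ∧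
      (∀ x' : X', Scheme.hsFun X' N x' ≤ Scheme.hsFun X N (π.base x')) ∧
      ∀ ν : ℕ → ℕ, Maximal (· ∈ Scheme.hsValues X N) ν → ν ∉ Scheme.hsValues X' N :=
  sigmaMaxModifications_of_isolated_of_resolutions 2
    (fun Y _ _ _ hexc hdimY => hCJS Y hexc (by exact_mod_cast hdimY)) f hreg
    (by exact_mod_cast hdim2) hdim hcl hdisj

end Summit.ResolutionOfSingularities.ResolutionOfSingularities.Theorems.SigmaMaxModifications.Sketch

end
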